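import Summits.KontsevichZagierPeriods.Zeta5Search.Barrier.ConeGammaEnvelopeFirstOrder
import Summits.KontsevichZagierPeriods.Zeta5Search.Barrier.ConeGammaCritFarCert

/-!
# ζ(5) search — BARRIER: THE ENVELOPE BOUND WITHOUT CALCULUS — `C₁` to first order on a box

HONEST FRAMING (cell `pub-zeta5`): systematic search; no irrationality claim unless kernel-certified. Theorems only. MODEL
objects under Brown–Zudilin's (28)+(30) ((28) observed, not proved): `C₁ = C1` of `ConeGammaRates` (largest critical value
of BZ's §5 growth functional), cert-2 g38's far-point certificate `CritFar.critFarCheck` (identification of the three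
critical values under `Regular`) and cert-2 g39's first-order checker `Envelope.envBoxCheck`. Every statement is an
enclosure of `C₁` on a direction box RELATIVE TO ITS VALUE AT THE BOX CENTRE; nothing about any γ, the cone's supremum
(C2 OPEN), S-E (CONJECTURED), (TD_A) or `ζ(5)`; no number of record moves; records in print UNMOVED. Theory seat cert-2 g39
(item «THE ENVELOPE BOUND FOR C₁ WITHOUT CALCULUS», part 4a).

* `exists_near_loc_of_rootCheck` — cert-2 g37/g38's near critical point, re-derived WITH ITS LOCATION
  `|Q·X − cx| ≤ Σ|ax| + wx`, `|Q·Y − cv| ≤ Σ|av| + wv` (adapted from `CritFar.exists_near_of_rootCheck`, disclosed copy);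
* `tubeOfRoot` — that moving box frozen to its hull, as an `Envelope.Tube`;
* **`exists_C1_point_of_critFarCheck`** — under `critFarCheck` and `Regular (aOfS t)`: `C₁(aOfS t)` IS the value of the
  growth functional at a critical point lying in `tubeOfRoot r2` (the identification of cert-2 g38's
  `bounds_aOfS_of_critFarCheck`, re-derived with the location; adapted copy, disclosed);
The first-order statements for `C₁` built on this identification are in `ConeGammaEnvelopeC1Box`.
-/

noncomputable section

open Set
open Literature.Analysis.ValidatedNumerics.NumericsMP

namespace Summit.KontsevichZagierPeriods.Zeta5Search.Barrier.ConeGamma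

namespace Envelope

open Literature.Analysis.ValidatedNumerics (AForm)
open Literature.Analysis.ValidatedNumerics.AForm
open LemmaFBox (SC SC_pos box centre centre_mem)
open CritBox CritFar

/-! ### A near critical point with its location -/

/-- At the box centre every box noise vanishes. -/
theorem boxNoise_centre {D : ℕ} (hD : 0 < D) (lo hi : List ℕ) (i : Fin 8) :
    boxNoise D lo hi (centre D lo hi) i = 0 := by
  unfold boxNoise
  simp only [centre]
  have hD' : (0 : ℝ) < D := by exact_mod_cast hD
  have : (2 : ℝ) * D * ((((lo.getD i 0 : ℕ) : ℝ) + ((hi.getD i 0 : ℕ) : ℝ)) / (2 * D)) - ((lo.getD i 0 : ℕ) : ℝ)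
      - ((hi.getD i 0 : ℕ) : ℝ) = 0 := by field_simp; ring
  rw [this, zero_div]

/-- At the box centre the linear noise part of a moving coordinate vanishes. -/
theorem linR_noise_centre (a : List ℤ) {D : ℕ} (hD : 0 < D) (lo hi : List ℕ) (η₁ η₂ : ℝ) :
    linR a (noise D lo hi (centre D lo hi) η₁ η₂) = 0 := by
  simp [linR, noise, boxNoise_centre hD]

/-- **A NEAR critical point with value AND LOCATION** (cert-2 g37's near branch / g38's `exists_near_of_rootCheck`,
re-derived keeping both coordinates): for near data with `rootCheck = some (l, u)`, every box direction has a critical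
point `(X + t₆, Y + t₆)` with value in `[l/SC, u/SC]`, `|Q·X − cx| ≤ Σ|ax| + wx` and `|Q·Y − cv| ≤ Σ|av| + wv`
(`Q = 2·D·T`). Adapted from `ConeGammaCritFarNear` (cert-2 g38). -/
theorem exists_near_loc_of_rootCheck {D T : ℕ} {lo hi : List ℕ} {t : Fin 8 → ℝ} (hok : boxOKc D lo hi = true)
    (hT : 0 < T) (h : t ∈ LemmaFBox.box D lo hi) (ht0 : t 0 = 1) {rd : RootData} (hfar : rd.far = false)
    (hlenx : rd.ax.length = 7) (hlen : rd.av.length = 7) {l u : ℤ} (hrc : rootCheck D T lo hi rd = some (l, u)) :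
    ∃ X Y : ℝ, IsCritical (aOfS t) (X + t 6) (Y + t 6) ∧
      (l : ℝ) ≤ growthLogR (pR (aOfS t)) (qR (aOfS t)) (X + t 6) (Y + t 6) * SC ∧
      growthLogR (pR (aOfS t)) (qR (aOfS t)) (X + t 6) (Y + t 6) * SC ≤ (u : ℝ) ∧
      |X * ((2 * D * T : ℕ) : ℝ) - rd.cx| ≤ ((absSum rd.ax + rd.wx : ℕ) : ℝ) ∧
      |Y * ((2 * D * T : ℕ) : ℝ) - rd.cv| ≤ ((absSum rd.av + rd.wv : ℕ) : ℝ) ∧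
      (t = centre D lo hi → |X * ((2 * D * T : ℕ) : ℝ) - rd.cx| ≤ (rd.wx : ℝ) ∧
        |Y * ((2 * D * T : ℕ) : ℝ) - rd.cv| ≤ (rd.wv : ℝ)) := by
  have hD : 0 < D := by
    have := hok; simp only [boxOKc, decide_eq_true_eq] at this; exact this.1
  set Qn : ℕ := 2 * D * T with hQn
  have hQ : 0 < Qn := by rw [hQn]; exact Nat.mul_pos (Nat.mul_pos (by norm_num) hD) hT
  unfold rootCheck at hrc
  dsimp only at hrc
  split at hrc
  · rename_i hcond
    obtain ⟨hface, _, _, hwx, hwv, _, hdet⟩ := hcond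
    split at hrc
    · rename_i G hG
      simp only [Option.some.injEq, Prod.mk.injEq] at hrc
      obtain ⟨rfl, rfl⟩ := hrc
      obtain ⟨η₁, η₂, hη₁, hη₂, hzero⟩ := exists_zero_of_faceCheck hok hT h ht0 hface hwx hwv hdet
      have hv := valid_noise hok h hη₁ hη₂
      set ε := noise D lo hi t η₁ η₂ with hε
      set P := boxPt D T lo hi rd t η₁ η₂ with hP
      have htA := tAF_mem hok h ht0 hη₁ hη₂
      have hQc : ((Qn : ℕ) : ℝ) = 2 * (D : ℝ) * T := by rw [hQn]; push_cast; ring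
      have hX : mem SC ε P.1 (coordAF rd.cx rd.ax rd.wx 8 Qn) := by
        have := coordAF_mem hv rd.cx rd.ax rd.wx hQ 8 (Or.inl rfl)
        rw [hQc] at this
        simpa [hP, boxPt, hε, noise] using this
      have hV : mem SC ε P.2 (coordAF rd.cv rd.av rd.wv 9 Qn) := by
        have := coordAF_mem hv rd.cv rd.av rd.wv hQ 9 (Or.inr rfl)
        rw [hQc] at this
        simpa [hP, boxPt, hε, noise] using this
      unfold valueAF at hG
      rw [hfar] at hG hzero
      simp only [Bool.false_eq_true, if_false] at hG
      have hF := forall₂_zip (coefs_forall₂ htA) (argsNear_forall₂ htA hX hV)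
      have hall := List.rel_append hF (constTerms_forall₂ htA)
      obtain ⟨hne, hmem⟩ := logSum_mem hv _ _ hall hG
      have hQr : (0 : ℝ) < Qn := by exact_mod_cast hQ
      have hloc : ∀ (c : ℤ) (a : List ℤ) (w : ℕ) (η : ℝ), a.length = 7 → |η| ≤ 1 →
          |((c : ℝ) + linR a ε + w * η) / (Qn : ℝ) * (Qn : ℝ) - c| ≤ ((absSum a + w : ℕ) : ℝ) := by
        intro c a w η hl hη
        rw [div_mul_cancel₀ _ hQr.ne']
        have h1 := abs_linR_le hv hl
        have h2 : |(w : ℝ) * η| ≤ w := by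
          rw [abs_mul, abs_of_nonneg (by positivity : (0 : ℝ) ≤ w)]
          exact mul_le_of_le_one_right (by positivity) hη
        push_cast
        rw [show (c : ℝ) + linR a ε + w * η - c = linR a ε + w * η by ring]
        exact (abs_add_le _ _).trans (add_le_add h1 h2)
      have hlocc : ∀ (c : ℤ) (a : List ℤ) (w : ℕ) (η : ℝ), |η| ≤ 1 → t = centre D lo hi →
          |((c : ℝ) + linR a ε + w * η) / (Qn : ℝ) * (Qn : ℝ) - c| ≤ (w : ℝ) := by
        intro c a w η hη htc
        rw [div_mul_cancel₀ _ hQr.ne']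
        have h0 : linR a ε = 0 := by rw [hε, htc]; exact linR_noise_centre a hD lo hi η₁ η₂
        have h2 : |(w : ℝ) * η| ≤ w := by
          rw [abs_mul, abs_of_nonneg (by positivity : (0 : ℝ) ≤ w)]
          exact mul_le_of_le_one_right (by positivity) hη
        rw [h0, show (c : ℝ) + 0 + w * η - c = w * η by ring]
        exact h2
      have hP1 : P.1 = ((rd.cx : ℝ) + linR rd.ax ε + rd.wx * η₁) / (Qn : ℝ) := by
        simp [hP, boxPt, coordR, hε, hQn]
      have hP2 : P.2 = ((rd.cv : ℝ) + linR rd.av ε + rd.wv * η₂) / (Qn : ℝ) := by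
        simp [hP, boxPt, coordR, hε, hQn]
      refine ⟨P.1, P.2, ⟨?_, ?_, ?_⟩, ?_, ?_, ?_, ?_, fun htc => ⟨?_, ?_⟩⟩
      · have := congrArg Prod.fst hzero; simpa [sysR] using this
      · have := congrArg Prod.snd hzero; simpa [sysR] using this
      · intro k
        rw [critFactors_near]
        have hlen12 : (argsNearR t P.1 P.2).length = 12 := by simp [argsNearR]
        have hmemk : (argsNearR t P.1 P.2).getD k 0 ∈ argsNearR t P.1 P.2 := by
          rw [List.getD_eq_getElem _ _ (by rw [hlen12]; exact k.isLt)]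
          exact List.getElem_mem _
        have hlenc : (coefsR t).length = 12 := by simp [coefsR]
        obtain ⟨i, hi, hgi⟩ := List.getElem_of_mem hmemk
        have hz : ((coefsR t)[i]'(by rw [hlenc]; rw [hlen12] at hi; exact hi), (argsNearR t P.1 P.2)[i]) ∈
            ((coefsR t).zip (argsNearR t P.1 P.2)) ++ constTermsR t := by
          apply List.mem_append_left
          rw [List.mem_iff_getElem]
          refine ⟨i, by simp [hlenc, hlen12]; rw [hlen12] at hi; exact hi, ?_⟩
          simp
        have := hne _ hz
        simpa [hgi] using this
      · rw [growthLogR_near]; exact lo_le hv hmem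
      · rw [growthLogR_near]; exact le_hi hv hmem
      · rw [hP1]; exact hloc _ _ _ _ hlenx hη₁
      · rw [hP2]; exact hloc _ _ _ _ hlen hη₂
      · rw [hP1]; exact hlocc _ _ _ _ hη₁ htc
      · rw [hP2]; exact hlocc _ _ _ _ hη₂ htc
    · exact absurd hrc (by simp)
  · exact absurd hrc (by simp)

/-- The moving root box of `rd` frozen to its hull: `cx ± (Σ|ax_j| + wx)`, `cv ± (Σ|av_j| + wv)` (scale `Q = 2·D·T`). -/
def tubeOfRoot (rd : RootData) : Tube :=
  ⟨rd.cx - ((absSum rd.ax + rd.wx : ℕ) : ℤ), rd.cx + ((absSum rd.ax + rd.wx : ℕ) : ℤ),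
   rd.cv - ((absSum rd.av + rd.wv : ℕ) : ℤ), rd.cv + ((absSum rd.av + rd.wv : ℕ) : ℤ)⟩

/-- The location bounds put the point in `tubeOfRoot`. -/
theorem mem_tubeOfRoot {D T : ℕ} {rd : RootData} {X Y : ℝ}
    (hX : |X * ((2 * D * T : ℕ) : ℝ) - rd.cx| ≤ ((absSum rd.ax + rd.wx : ℕ) : ℝ))
    (hY : |Y * ((2 * D * T : ℕ) : ℝ) - rd.cv| ≤ ((absSum rd.av + rd.wv : ℕ) : ℝ)) :
    (X, Y) ∈ tube D T (tubeOfRoot rd) := by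
  have e : ((2 * D * T : ℕ) : ℝ) = 2 * (D : ℝ) * T := by push_cast; ring
  rw [e] at hX hY
  obtain ⟨a1, a2⟩ := abs_le.mp hX
  obtain ⟨b1, b2⟩ := abs_le.mp hY
  push_cast at a1 a2 b1 b2
  simp only [tube, tubeOfRoot, Set.mem_setOf_eq]
  push_cast
  refine ⟨⟨?_, ?_⟩, ?_, ?_⟩ <;> linarith

/-! ### `C₁` is the value at the critical point in the tube of `r2` -/

/-- **The top critical value with its location** (the identification of cert-2 g38's `bounds_aOfS_of_critFarCheck`,
re-derived keeping the location of the near root `r2`): under `critFarCheck` and `Regular (aOfS t)`, for every box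
direction there is a critical point `(X + t₆, Y + t₆)` with `(X, Y) ∈ tubeOfRoot r2` whose value is EXACTLY `C₁(aOfS t)`.
Adapted from `ConeGammaCritFarCert` (cert-2 g38); `r2.ax.length = 7` is the one extra (decidable) hypothesis. -/
theorem exists_C1_point_of_critFarCheck {D T : ℕ} {lo hi : List ℕ} {r0 r2 : RootData} {fd : FarData}
    {c0lo c0hi c1hi : ℤ} {den : ℕ} (hc : critFarCheck D T lo hi r0 r2 fd c0lo c0hi c1hi den = true)
    (hlenx : r2.ax.length = 7)
    {t : Fin 8 → ℝ} (h : t ∈ LemmaFBox.box D lo hi) (ht0 : t 0 = 1) (hreg : Regular (aOfS t)) :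
    ∃ X Y : ℝ, IsCritical (aOfS t) (X + t 6) (Y + t 6) ∧ (X, Y) ∈ tube D T (tubeOfRoot r2) ∧
      C1 (aOfS t) = growthLogR (pR (aOfS t)) (qR (aOfS t)) (X + t 6) (Y + t 6) ∧
      |X * ((2 * D * T : ℕ) : ℝ) - r2.cx| ≤ ((absSum r2.ax + r2.wx : ℕ) : ℝ) ∧
      |Y * ((2 * D * T : ℕ) : ℝ) - r2.cv| ≤ ((absSum r2.av + r2.wv : ℕ) : ℝ) ∧
      (t = centre D lo hi → |X * ((2 * D * T : ℕ) : ℝ) - r2.cx| ≤ (r2.wx : ℝ) ∧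
        |Y * ((2 * D * T : ℕ) : ℝ) - r2.cv| ≤ (r2.wv : ℝ)) := by
  -- unpack the checker
  unfold critFarCheck at hc
  split at hc
  · rename_i h0 l1 h1 l2 h2 hr0 hfc hr2
    simp only [Bool.and_eq_true, decide_eq_true_eq, nearSep] at hc
    obtain ⟨⟨⟨hok, hsep0⟩, hsep2⟩, hT, hden, hfar0, hfar2, hlen0, hlen2, h02, h12, hC1, hC0lo, hC0hi⟩ := hc
    have hD : 0 < D := by
      have := hok; simp only [boxOKc, decide_eq_true_eq] at this; exact this.1
    have hopen := openBox_of_box hok h ht0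
    have h6 := hopen 5
    change 0 < t 6 ∧ t 6 < t 0 at h6
    have hSC : (0 : ℝ) < SC := by exact_mod_cast SC_pos
    set Qn : ℕ := 2 * D * T with hQn
    have hQ : 0 < Qn := by rw [hQn]; exact Nat.mul_pos (Nat.mul_pos (by norm_num) hD) hT
    have hQr : (0 : ℝ) < Qn := by exact_mod_cast hQ
    -- the two near critical points (root 2 with its location)
    obtain ⟨X0, Y0, hk0, hl0, hu0, hloc0⟩ := exists_near_of_rootCheck hok hT h ht0 hfar0 hlen0 hr0
    obtain ⟨X2, Y2, hk2, hl2, hu2, hlocX2, hlocY2, hlocc⟩ := exists_near_loc_of_rootCheck hok hT h ht0 hfar2 hlenx hlen2 hr2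
    have hloc2 : |Y2| * ((2 * D * T : ℕ) : ℝ) ≤ ((r2.cv.natAbs + absSum r2.av + r2.wv : ℕ) : ℝ) := by
      have hQ0 : (0 : ℝ) ≤ ((2 * D * T : ℕ) : ℝ) := by positivity
      have e : |Y2| * ((2 * D * T : ℕ) : ℝ) = |Y2 * ((2 * D * T : ℕ) : ℝ)| := by rw [abs_mul, abs_of_nonneg hQ0]
      have tri : |Y2 * ((2 * D * T : ℕ) : ℝ)| ≤ |Y2 * ((2 * D * T : ℕ) : ℝ) - r2.cv| + |(r2.cv : ℝ)| := by
        have := abs_add_le (Y2 * ((2 * D * T : ℕ) : ℝ) - r2.cv) (r2.cv : ℝ)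
        rwa [sub_add_cancel] at this
      have hcv : |(r2.cv : ℝ)| = ((r2.cv.natAbs : ℕ) : ℝ) := by rw [Nat.cast_natAbs, Int.cast_abs]
      rw [e]
      push_cast at hlocY2 tri hcv ⊢
      rw [hcv] at tri
      linarith
    clear hr0 hr2
    -- unpack the far check; the sign change
    unfold farCheck at hfc
    split at hfc
    swap
    · exact absurd hfc (by simp)
    rename_i hfcond
    obtain ⟨⟨hzden, hzlt, hzlo, hzhi, hpieces, hsg⟩, hall⟩ := hfcond
    simp only [Option.some.injEq, Prod.mk.injEq] at hfc
    obtain ⟨hl1, hh1v⟩ := hfc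
    obtain ⟨z₁, hz₁, hrz⟩ := exists_revC_zero hok hT h ht0 hzden hzlt hzlo hzhi hsg
    clear hsg
    obtain ⟨hz₁0, hroot1⟩ := root_of_revC_zero hopen hreg hrz
    set Y1 : ℝ := z₁⁻¹ with hY1
    -- the far root is far
    have hzabs : |z₁| * fd.zden ≤ (zAbsMax fd : ℝ) := by
      have hzd : (0 : ℝ) < fd.zden := by exact_mod_cast hzden
      have hlo' : ((fd.zlo : ℤ) : ℝ) ≤ z₁ * fd.zden := by have := hz₁.1; rw [div_lt_iff₀ hzd] at this; linarith
      have hhi' : z₁ * fd.zden ≤ ((fd.zhi : ℤ) : ℝ) := by have := hz₁.2; rw [lt_div_iff₀ hzd] at this; linarith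
      rw [← abs_of_pos hzd, ← abs_mul, abs_le]
      have hm1 : ((fd.zlo.natAbs : ℕ) : ℝ) ≤ (zAbsMax fd : ℝ) := by exact_mod_cast le_max_left _ _
      have hm2 : ((fd.zhi.natAbs : ℕ) : ℝ) ≤ (zAbsMax fd : ℝ) := by exact_mod_cast le_max_right _ _
      rw [Nat.cast_natAbs, Int.cast_abs] at hm1 hm2
      constructor
      · linarith [neg_abs_le (fd.zlo : ℝ)]
      · linarith [le_abs_self (fd.zhi : ℝ)]
    have hfarsep : ∀ {rd : RootData} {Y : ℝ},
        |Y| * ((2 * D * T : ℕ) : ℝ) ≤ ((rd.cv.natAbs + absSum rd.av + rd.wv : ℕ) : ℝ) →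
        (rd.cv.natAbs + absSum rd.av + rd.wv) * zAbsMax fd < 2 * D * T * fd.zden → Y ≠ Y1 := by
      intro rd Y hloc hsep hYeq
      have hsep' : (((rd.cv.natAbs + absSum rd.av + rd.wv) * zAbsMax fd : ℕ) : ℝ) < ((2 * D * T * fd.zden : ℕ) : ℝ) := by
        exact_mod_cast hsep
      push_cast at hsep' hloc
      have hYz : |Y| * |z₁| = 1 := by rw [hYeq, hY1, ← abs_mul, inv_mul_cancel₀ hz₁0, abs_one]
      have hzdpos : (0 : ℝ) < fd.zden := by exact_mod_cast hzden
      have e : |Y| * (2 * (D : ℝ) * T) * (|z₁| * fd.zden) = 2 * (D : ℝ) * T * fd.zden := by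
        calc |Y| * (2 * (D : ℝ) * T) * (|z₁| * fd.zden) = (|Y| * |z₁|) * (2 * (D : ℝ) * T * fd.zden) := by ring
          _ = _ := by rw [hYz, one_mul]
      have hM : (0 : ℝ) ≤ (rd.cv.natAbs : ℝ) + (absSum rd.av : ℝ) + (rd.wv : ℝ) := by positivity
      have := mul_le_mul hloc hzabs (by positivity) hM
      rw [e] at this
      linarith
    have hne01 : Y0 ≠ Y1 := hfarsep hloc0 hsep0
    have hne21 : Y2 ≠ Y1 := hfarsep hloc2 hsep2
    -- values
    set v0 := growthLogR (pR (aOfS t)) (qR (aOfS t)) (X0 + t 6) (Y0 + t 6) with hv0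
    set v2 := growthLogR (pR (aOfS t)) (qR (aOfS t)) (X2 + t 6) (Y2 + t 6) with hv2
    have h02' : ((h0 : ℤ) : ℝ) < l2 := by exact_mod_cast h02
    have hv02 : v0 < v2 := lt_of_mul_lt_mul_right (by linarith : v0 * SC < v2 * SC) hSC.le
    obtain ⟨hC0r, hP0, hQ0, hx0⟩ := isCritical_aOfS_root (s := t) (P := cubicP t) (Q := cubicQ t) (C := cubicC t)
      (fun _ => rfl) (fun _ => rfl) (fun _ => rfl) h6.2.ne hk0
    obtain ⟨hC2r, hP2, hQ2, hx2⟩ := isCritical_aOfS_root (s := t) (P := cubicP t) (Q := cubicQ t) (C := cubicC t)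
      (fun _ => rfl) (fun _ => rfl) (fun _ => rfl) h6.2.ne hk2
    simp only [add_sub_cancel_right] at hC0r hP0 hQ0 hx0 hC2r hP2 hQ2 hx2
    have hne02 : Y0 ≠ Y2 := by
      intro heq
      apply hv02.ne
      rw [hv0, hv2, hx0, hx2, heq]
    have himg := critVals_aOfS_eq_image (s := t) (P := cubicP t) (Q := cubicQ t) (C := cubicC t)
      (fun _ => rfl) (fun _ => rfl) (fun _ => rfl) h6.2.ne
    set V : ℝ → ℝ := fun Y => growthLogR (pR (aOfS t)) (qR (aOfS t))
      (t 6 - Y + (t 6 - t 0) * cubicP t Y / cubicQ t Y) (Y + t 6) with hV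
    set Adm : Set ℝ := {Y | cubicC t Y = 0 ∧ cubicQ t Y ≠ 0 ∧
      ∀ k, critFactors (pR (aOfS t)) (qR (aOfS t)) (t 6 - Y + (t 6 - t 0) * cubicP t Y / cubicQ t Y) (Y + t 6) k ≠ 0}
      with hAdm
    have himg' : critVals (aOfS t) = V '' Adm := himg
    obtain ⟨hRfin, hRle⟩ := cubicFun_roots_finite (C := cubicC t) (fun Y => cubicC_eq_poly t Y)
      (Y₀ := t 1) (cubic_at_s1_neg (s := t) (C := cubicC t) (fun _ => rfl) hopen).ne
    have hsub3 : ({Y0, Y1, Y2} : Set ℝ) ⊆ {Y | cubicC t Y = 0} := by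
      intro Y hY
      simp only [Set.mem_insert_iff, Set.mem_singleton_iff] at hY
      rcases hY with rfl | rfl | rfl
      · exact hC0r
      · exact hroot1
      · exact hC2r
    have hthree : ({Y0, Y1, Y2} : Set ℝ).ncard = 3 :=
      Set.ncard_eq_three.mpr ⟨Y0, Y1, Y2, hne01, hne02, hne21.symm, rfl⟩
    have hRoots : {Y | cubicC t Y = 0} = {Y0, Y1, Y2} :=
      (Set.eq_of_subset_of_ncard_le hsub3 (by rw [hthree]; exact hRle) hRfin).symm
    have hAdmSub : Adm ⊆ {Y0, Y1, Y2} := fun Y hY => by rw [← hRoots]; exact hY.1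
    have hAdmfin : Adm.Finite := (Set.toFinite _).subset hAdmSub
    have hAdm3 : Adm = {Y0, Y1, Y2} := by
      apply Set.eq_of_subset_of_ncard_le hAdmSub _ (Set.toFinite _)
      rw [hthree]
      have : (critVals (aOfS t)).ncard = 3 := hreg
      rw [himg'] at this
      have := Set.ncard_image_le (f := V) hAdmfin
      omega
    have hY1adm : Y1 ∈ Adm := by rw [hAdm3]; simp
    obtain ⟨_, hQ1, hfac1⟩ := hY1adm
    -- the far value is below `v2`
    have hY10 : Y1 ≠ 0 := inv_ne_zero hz₁0
    obtain ⟨hD1, hx1⟩ := x_eq_of_root t hY10 hQ1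
    rw [hY1, inv_inv] at hD1 hx1
    obtain ⟨j, hj, η, hη, hzj⟩ := exists_piece hzden hzlt hpieces hz₁
    obtain ⟨G, hG, hGl, hGh⟩ := pieceOK_sound (List.all_eq_true.mp hall j (List.mem_range.mpr hj))
    rw [hl1] at hGl; rw [hh1v] at hGh
    have hv := valid_noise hok h (show |(0 : ℝ)| ≤ 1 by simp) hη
    set ε := noise D lo hi t 0 η with hε
    have htA := tAF_mem hok h ht0 (show |(0 : ℝ)| ≤ 1 by simp) hη
    have hzmem : mem SC ε z₁ (zPieceAF fd j) := by
      have hQ' : 0 < 2 * fd.pieces * fd.zden := Nat.mul_pos (Nat.mul_pos (by norm_num) hpieces) hzden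
      have := coordAF_mem hv (2 * (fd.pieces : ℤ) * fd.zlo + (2 * (j : ℤ) + 1) * (fd.zhi - fd.zlo))
        [0, 0, 0, 0, 0, 0, 0] (fd.zhi - fd.zlo).toNat hQ' 9 (Or.inr rfl)
      have e9 : ε 9 = η := by simp [hε, noise]
      rw [zPieceAF]
      convert this using 2
      rw [coordR, e9, hzj]
      simp [linR]
    obtain ⟨_, hnum1, hmem1⟩ := farValueAF_sound hv htA hzmem hG
    have hVY1 : V Y1 = farSum t (xNum t z₁ / xDen t z₁) z₁ := by
      have e1 : t 6 - Y1 + (t 6 - t 0) * cubicP t Y1 / cubicQ t Y1 = xNum t z₁ / xDen t z₁ + t 6 := by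
        rw [hY1, ← hx1]; ring
      have e2 : Y1 + t 6 = z₁⁻¹ + t 6 := by rw [hY1]
      simp only [hV]
      rw [e1, e2, growthLogR_far t _ hz₁0 hnum1, farSum]
    have hh1 : V Y1 * SC ≤ ((h1 : ℤ) : ℝ) := by
      rw [hVY1]; exact le_trans (le_hi hv hmem1) (by exact_mod_cast hGh)
    have hVY0 : V Y0 = v0 := by simp only [hV, hv0, hx0]
    have hVY2 : V Y2 = v2 := by simp only [hV, hv2, hx2]
    have hcv : critVals (aOfS t) = {v0, V Y1, v2} := by
      rw [himg', hAdm3, Set.image_insert_eq, Set.image_insert_eq, Set.image_singleton, hVY0, hVY2]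
    have h12' : ((h1 : ℤ) : ℝ) < l2 := by exact_mod_cast h12
    have hv12 : V Y1 < v2 := lt_of_mul_lt_mul_right (by linarith : V Y1 * SC < v2 * SC) hSC.le
    obtain ⟨hsup, _⟩ := sSup_three hv02 hv12
    have hC1eq : C1 (aOfS t) = v2 := by rw [C1, hcv, hsup]
    exact ⟨X2, Y2, hk2, mem_tubeOfRoot hlocX2 hlocY2, hC1eq, hlocX2, hlocY2, hlocc⟩
  · exact absurd hc (by simp)

end Envelope

end Summit.KontsevichZagierPeriods.Zeta5Search.Barrier.ConeGamma

end
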